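import Summits.BirchSwinnertonDyer.Rank1Residual.GaloisImage.ExoticNoLevelTwoTau
import Summits.BirchSwinnertonDyer.Rank1Residual.GaloisImage.KolyvaginPrimeSmallImageTorsion
import Literature.NumberTheory.EllipticCurves.CyclicIsogenyCharacterFrobeniusProofs
import Literature.NumberTheory.EllipticCurves.KuriharaNumberInvariants
import Literature.NumberTheory.Automorphic.BCDTTheoremBWildAtThreeDet
import HarnessLib

/-!
# On an EXOTIC row (`surj(3) ∧ ¬surj(9)`) no Kolyvagin prime of depth `2` is TRANSVERSAL: the
# Kurihara / KURX depth-`≥ 2` candidate lists are EMPTY — control C-EXO as a kernel theorem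
# (cell `b2b-bsdres`, lane CLASS-CLOSURE, seat cc-typer-1 = typer of record N11 / O8, GEN 11;
# E2 obstruction anatomy of N11, row `tower3:SURJ3-ONLY`; sequel of n1011-p13's `ExoticNoLevelTwoTau`)

HONEST FRAMING (cell `b2b-bsdres`, run/shared/lean/b2b/bsd-rank1-residual/, verbatim in every
file): the goal of the cell is to DELETE the COMBINATION-SHAPED residual classes of the
Birch–Swinnerton-Dyer formula for ALL analytic-rank `≤ 1` elliptic curves over `ℚ` — "full BSD
formula for every rank `≤ 1` curve in class `C`" assembled STRICTLY from published theorems — so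
that the rank-`≤ 1` remainder becomes exactly the CONSTRUCTION-SHAPED classes, which are TYPED
(missing-input `Prop`s), NOT attempted. This is not "finishing BSD". THEOREMS ONLY: no definition,
no named fact, no conjecture node, nothing booked, no label of `RESIDUAL-MAP.md` moved; census
counts are EVIDENCE, never a Literature fact.

## What this file proves

n1011-p13 (`ExoticNoLevelTwoTau`, `not_levelTwoTau_of_surj_three_of_not_surj_nine`): on an EXOTIC
curve (`ρ̄_{E,3}` onto, `ρ̄_{E,9}` not onto — Elkies' `9`-deficient `3`-adic image) there is no
`τ ∈ Γ_{ℚ(μ₉)}` with `E[9]/(τ − 1)E[9] ≃ ℤ/9`. Here the Frobenius / reduction dictionary turns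
this into the statement the Kurihara-number engines test (ENG-A KURX "transversal candidates",
amendment 3; the second conjunct of the cell's `IsCyclicKolyvaginLevel`):

* **`three_lt_natCard_torsion_intModel_of_exotic`** — for `E/ℚ` exotic at `3` and EVERY Kolyvagin
  prime `ℓ` of depth `2` (`Kato.IsKolyvaginPrime W 3 2 ℓ`: `ℓ ∤ 3N`, `ℓ ≡ 1`, `a_ℓ ≡ ℓ + 1 (mod 9)`),
  the `3`-torsion of the reduction `(E₀ mod ℓ)(𝔽_ℓ)` has MORE than `3` points (it is `(ℤ/3)²`:
  `Ẽ(𝔽_ℓ)[9]` is NOT cyclic — `ℓ` is not transversal).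
* **`eq_one_of_isKolyvaginProduct_two_of_isCyclicKolyvaginLevel_of_exotic`** — hence a cyclic
  Kolyvagin level `n` of `(E, 3)` all of whose primes have depth `2` is `n = 1`: the depth-`≥ 2`
  transversal candidate lists are EMPTY on exotic rows (control C-EXO of cc-typer-1's INBOX
  pre-registration, now a theorem; companion of C-IMG for the small-image rows, GEN 2
  `eq_one_of_isCyclicKolyvaginLevel_of_irr_of_not_surj`).

PROOF. Let `σ₀ ∈ Γ_ℚ` be an arithmetic Frobenius above `ℓ` (the tree's `resGalOfEmb ι σ_v` along an
embedding `ℚ̄ → ℚ̄_v`, which intertwines the reduction map on `3`-primary torsion with `x ↦ x^ℓ`: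
`exists_reduceTorsionHom`, Silverman VII.2.1 / VII.3.1(b)). (1) `χ₉(σ₀) = ℓ ≡ 1`, so
`σ₀ ∈ Γ_{ℚ(μ₉)}`. (2) Manin's relation `φ² − a_ℓ φ + ℓ = 0` on `Ẽ(𝔽̄_ℓ)` pulled back along the
injective reduction map gives `σ₀² − a_ℓ σ₀ + ℓ = 0` on `E[3^∞]`; on `M = E[9]`, with
`a_ℓ ≡ 2`, `ℓ ≡ 1 (mod 9)`, this is `F² = 0` for `F = σ₀ − 1`, so `R = F(M) ≤ K = ker F`.
(3) `K` — the `σ₀`-fixed points of `E[9]` — embeds additively into the `𝔽_ℓ`-points of the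
reduction (fixed by `x ↦ x^ℓ`) and then into `(E₀ mod ℓ)(ZMod ℓ)` (additive-p3's
`exists_addMonoidHom_reductionAt_intModel`); if the latter had `≤ 3` points of order dividing `3`,
then `#K[3] ≤ 3`, hence `#K ≤ #K[3] · #3K ≤ 9`, and with `#M = 81 = #R · #K`, `#R ≤ #K` one gets
`#R = #K = 9`, `R = K` CYCLIC of order `9` (an element of `K` outside `K[3]` has order `9`), so
`M/F(M) = M/K ≃ K ≃ ℤ/9` — the forbidden `τ = σ₀`. Pure counting; no basis of `E[9]`.

Consequence for the lane (EVIDENCE from cc-eng-1's `N11/E2-hypotheses.tsv.gz`, token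
`tower3:SURJ3-ONLY`): the 20 exotic N11 rows (all rank `0`, wild `f = 5`) carry Kurihara
`ν`-certificates at depth `1` only; the four with `ord₃ ∏ c_ℓ = 1` (`388800ha1`, `388800ho1`,
`388800ii1`, `388800ij1`) are out of reach of transversal Kurihara numbers at every search bound.
NOT claimed: anything about non-transversal (non-cyclic) levels, about depth `1`, or about BSD; no
label moves.

References: [Sakamoto2024] R. Sakamoto, JTNB 36 (2024) §2 (H.2); [Kim2022StructureSelmer] C.-H. Kim,
§1.2.2 (`𝒫_k`, `𝒩_k`), Thm. 2.1; [Kurihara2014] M. Kurihara, Münster J. Math. 7 (2014) §3.1;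
[Elkies2006] N. Elkies, arXiv:math/0612734; [SilvermanAEC2009] V.2.3.1(b), VII.2.1, VII.3.1(b),
III.6.4(b); [MazurRubin2004] §3.5.
-/

set_option autoImplicit false

noncomputable section

open scoped Classical NumberField

open NumberField IsDedekindDomain IsDedekindDomain.HeightOneSpectrum Field WeierstrassCurve
  CongruenceSubgroup
  Literature.NumberTheory.EllipticCurves Literature.NumberTheory.GaloisRepresentations
  Literature.NumberTheory.GaloisRepresentations.DiscreteGaloisModule
  Literature.NumberTheory.GaloisCohomology
  Literature.NumberTheory.EllipticCurves.Rank1Residual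

namespace Summit.BirchSwinnertonDyer.Rank1Residual.GaloisImage

/-! ## §1. Counting lemmas on finite abelian groups (orders `9`, `81`) -/

namespace ExoticDepthTwo

/-- A finite abelian group killed by `9` whose `3`-torsion has at most `3` elements has at most `9`
elements (`#K = #K[3] · #3K` and `3K ⊆ K[3]`). [folklore] -/
theorem natCard_le_nine {K : Type*} [AddCommGroup K] [Finite K] (h9 : ∀ y : K, (9 : ℕ) • y = 0)
    (h3 : Nat.card {y : K // (3 : ℕ) • y = 0} ≤ 3) : Nat.card K ≤ 9 := by
  set ψ : K →+ K := DistribSMul.toAddMonoidHom K (3 : ℕ) with hψ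
  have hψapp : ∀ y : K, ψ y = (3 : ℕ) • y := fun y => rfl
  -- `#K = #(K/ker ψ) · #ker ψ = #range ψ · #ker ψ`
  have hcard := AddSubgroup.card_eq_card_quotient_mul_card_addSubgroup ψ.ker
  have hq : Nat.card (K ⧸ ψ.ker) = Nat.card ψ.range :=
    Nat.card_congr (QuotientAddGroup.quotientKerEquivRange ψ).toEquiv
  -- `ker ψ ≃ K[3]`
  have hker : Nat.card ψ.ker = Nat.card {y : K // (3 : ℕ) • y = 0} :=
    Nat.card_congr (Equiv.subtypeEquivRight fun y => by rw [AddMonoidHom.mem_ker, hψapp])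
  -- `range ψ ↪ K[3]`
  have hran : Nat.card ψ.range ≤ Nat.card {y : K // (3 : ℕ) • y = 0} := by
    refine Nat.card_le_card_of_injective (fun z => ⟨(z : K), ?_⟩) ?_
    · obtain ⟨y, hy⟩ := z.2
      rw [← hy, hψapp, smul_smul]
      exact h9 y
    · intro z₁ z₂ h
      have h' : (z₁ : K) = (z₂ : K) := congrArg (fun w : {y : K // (3 : ℕ) • y = 0} => (w : K)) h
      exact Subtype.ext h'
  rw [hcard, hq, hker]
  calc Nat.card ψ.range * Nat.card {y : K // (3 : ℕ) • y = 0}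
      ≤ 3 * 3 := Nat.mul_le_mul (hran.trans h3) h3
    _ = 9 := by norm_num

/-- If `#M = 81`, `F : M → M` is additive with `F ∘ F = 0` and `#ker F ≤ 9`, then `#ker F = 9` and
`F(M) = ker F`. [folklore] -/
theorem range_eq_ker_of_sq_eq_zero {M : Type*} [AddCommGroup M] [Finite M]
    (hM : Nat.card M = 81) (F : M →+ M) (hF2 : ∀ y : M, F (F y) = 0)
    (hK : Nat.card F.ker ≤ 9) : Nat.card F.ker = 9 ∧ F.range = F.ker := by
  have hRK : F.range ≤ F.ker := by
    rintro _ ⟨y, rfl⟩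
    exact (AddMonoidHom.mem_ker).mpr (hF2 y)
  have hcard := AddSubgroup.card_eq_card_quotient_mul_card_addSubgroup F.ker
  have hq : Nat.card (M ⧸ F.ker) = Nat.card F.range :=
    Nat.card_congr (QuotientAddGroup.quotientKerEquivRange F).toEquiv
  rw [hM, hq] at hcard
  have hle : Nat.card F.range ≤ Nat.card F.ker := AddSubgroup.card_le_of_le hRK
  -- `81 = #R · #K ≤ #K², #K ≤ 9`
  have hK9 : Nat.card F.ker = 9 := by
    by_contra hne
    have hK8 : Nat.card F.ker ≤ 8 := by omega
    have : Nat.card F.range * Nat.card F.ker ≤ 8 * 8 := Nat.mul_le_mul (hle.trans hK8) hK8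
    omega
  refine ⟨hK9, ?_⟩
  have hR9 : Nat.card F.range = 9 := by
    rw [hK9] at hcard
    omega
  exact AddSubgroup.eq_of_le_of_card_ge hRK (by rw [hK9, hR9])

/-- A group of order `9` killed by `9` with at most `3` elements of order dividing `3` is cyclic.
[folklore] -/
theorem isAddCyclic_of_card_eq_nine {K : Type*} [AddCommGroup K] [Finite K] (hK : Nat.card K = 9)
    (h9 : ∀ y : K, (9 : ℕ) • y = 0) (h3 : Nat.card {y : K // (3 : ℕ) • y = 0} ≤ 3) :
    IsAddCyclic K := by
  -- some `y` with `3 • y ≠ 0`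
  obtain ⟨y, hy⟩ : ∃ y : K, (3 : ℕ) • y ≠ 0 := by
    by_contra h
    push Not at h
    have : Nat.card {y : K // (3 : ℕ) • y = 0} = Nat.card K :=
      Nat.card_congr (Equiv.subtypeUnivEquiv h)
    omega
  -- its order divides `9`, is not `1` or `3`, hence is `9`
  have hdvd : addOrderOf y ∣ 3 ^ 2 := addOrderOf_dvd_of_nsmul_eq_zero (h9 y)
  obtain ⟨i, hi, hiy⟩ := (Nat.dvd_prime_pow Nat.prime_three).mp hdvd
  have hne0 : y ≠ 0 := fun h0 => hy (by rw [h0, smul_zero])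
  interval_cases i
  · rw [pow_zero, AddMonoid.addOrderOf_eq_one_iff] at hiy
    exact absurd hiy hne0
  · exfalso
    apply hy
    rw [pow_one] at hiy
    rw [← hiy]
    exact addOrderOf_nsmul_eq_zero y
  · exact isAddCyclic_of_addOrderOf_eq_card y (by rw [hiy, hK]; norm_num)

end ExoticDepthTwo

/-! ## §2. Exotic rows: no transversal Kolyvagin prime of depth `2` -/

section Exotic

variable (W : WeierstrassCurve ℚ) [W.IsElliptic] [W.IsGloballyMinimal]

/-- **C-EXO.** For `E/ℚ` with `ρ̄_{E,3}` onto and `ρ̄_{E,9}` NOT onto (an exotic `3`-adic image) and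
every Kolyvagin prime `ℓ` of depth `2` at `p = 3` (`ℓ ∤ 3N`, `ℓ ≡ 1 (mod 9)`, `a_ℓ ≡ ℓ + 1 (mod 9)`),
the reduction `(E₀ mod ℓ)(𝔽_ℓ)` has MORE than `3` points killed by `3`: `Ẽ(𝔽_ℓ)[9]` is not cyclic,
`ℓ` is not a transversal prime. (Otherwise the Frobenius `σ₀` at `ℓ` — which fixes `μ₉` and
satisfies `(σ₀ − 1)² = 0` on `E[9]` by Manin's relation — would have `E[9]/(σ₀ − 1)E[9] ≃ ℤ/9`,
against n1011-p13's `not_levelTwoTau_of_surj_three_of_not_surj_nine`.)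
[cite: SilvermanAEC2009, Thm. V.2.3.1(b), Prop. VII.3.1(b)] [cite: Sakamoto2024, §2 (H.2)]
[cite: Kim2022StructureSelmer, §1.2.2] -/
theorem three_lt_natCard_torsion_intModel_of_exotic (hsurj : W.HasSurjectiveModNGaloisRep 3)
    (hns9 : ¬ W.HasSurjectiveModNGaloisRep 9) {ℓ : ℕ} [hℓF : Fact ℓ.Prime]
    (hK : Kato.IsKolyvaginPrime W 3 2 ℓ) :
    3 < Nat.card {P : ((integralModelInt W).map (Int.castRingHom (ZMod ℓ))).toAffine.Point //
      3 • P = 0} := by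
  by_contra hle
  push Not at hle
  haveI : Fact (Nat.Prime 3) := ⟨Nat.prime_three⟩
  have hℓ : ℓ.Prime := hℓF.out
  have hℓ3 : ℓ ≠ 3 := hK.ne
  have hgoodℓ : W.HasGoodReductionAtPrime ℓ :=
    hasGoodReductionAtPrime_of_not_dvd_conductorNorm W hK.not_dvd_conductorNorm
  -- the congruences `ℓ ≡ 1`, `a_ℓ ≡ 2 (mod 9)` as divisibilities in `ℤ`
  have hmod1 : ℓ ≡ 1 [MOD 3 ^ 2] := hK.modEq_one
  have hℓ9 : (9 : ℤ) ∣ (ℓ : ℤ) - 1 := by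
    have h := (Nat.modEq_iff_dvd' hℓ.one_lt.le).mp hmod1.symm
    have h' : ((3 ^ 2 : ℕ) : ℤ) ∣ ((ℓ - 1 : ℕ) : ℤ) := Int.natCast_dvd_natCast.mpr h
    rwa [Nat.cast_sub hℓ.one_lt.le, Nat.cast_pow, Nat.cast_one] at h'
  have ha9 : (9 : ℤ) ∣ W.frobeniusTrace ℓ - 2 := by
    have h := hK.frobeniusTrace_modEq
    have h' : ((3 ^ 2 : ℕ) : ℤ) ∣ (ℓ : ℤ) + 1 - W.frobeniusTrace ℓ := Int.ModEq.dvd h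
    rw [Nat.cast_pow] at h'
    have h'' : (9 : ℤ) ∣ ((ℓ : ℤ) + 1 - W.frobeniusTrace ℓ) + -((ℓ : ℤ) - 1) :=
      dvd_add (by simpa using h') (dvd_neg.mpr hℓ9)
    have e : ((ℓ : ℤ) + 1 - W.frobeniusTrace ℓ) + -((ℓ : ℤ) - 1) = -(W.frobeniusTrace ℓ - 2) := by ring
    rw [e, dvd_neg] at h''
    exact h''
  -- the place `v ∋ ℓ`
  set v : HeightOneSpectrum (𝓞 ℚ) := (Rat.HeightOneSpectrum.primesEquiv (R := 𝓞 ℚ)).symm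
    ⟨ℓ, hℓ⟩ with hvdef
  have hvℓ : (Rat.HeightOneSpectrum.primesEquiv v : ℕ) = ℓ := by
    rw [hvdef, Equiv.apply_symm_apply]
  have hv : (ℓ : 𝓞 ℚ) ∈ v.asIdeal := by
    rw [DeuringLadic.natCast_mem_asIdeal_iff v ℓ, hvℓ]
  have hgood : W.HasGoodReductionAt v :=
    (hasGoodReductionAtPrime_primesEquiv_iff_holds W v ℓ hvℓ).mp hgoodℓ
  have h3v : ((3 : ℕ) : 𝓞 ℚ) ∉ v.asIdeal := fun h ↦
    hℓ3 (hvℓ.symm.trans (primesEquiv_eq_of_natCast_mem Nat.prime_three h))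
  -- the reduction `Ẽ_v / k_v` and the reduction map on `3`-primary torsion
  set kv := IsLocalRing.ResidueField (v.adicCompletionIntegers ℚ) with hkv
  letI : Fintype kv := Fintype.ofFinite kv
  set Wt : WeierstrassCurve kv := W.reductionAt v with hWt
  haveI : Wt.IsElliptic := isElliptic_reductionAt hgood
  have hcardk : Fintype.card kv = ℓ := by
    rw [← Nat.card_eq_fintype_card, natCard_residueField_adicCompletionIntegers v, hvℓ]
  have hcardWt : Nat.card Wt.toAffine.Point = W.reductionPointCount ℓ := by
    rw [← hvℓ]
    exact natCard_point_reduction_minimal_baseChange v W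
  have htr : HasseManin.tr Wt = W.frobeniusTrace ℓ := by
    rw [HasseManin.tr, hcardk, hcardWt, frobeniusTrace]
  obtain ⟨𝔐, h𝔐⟩ := v.localPrimesAbove_nonempty
  let ι : AlgebraicClosure ℚ →ₐ[ℚ] AlgebraicClosure (v.adicCompletion ℚ) :=
    closureEmb (K := ℚ) (v.adicCompletion ℚ)
  obtain ⟨σL, hσL⟩ := v.exists_isArithFrobAt_localAbsIntegers h𝔐
  obtain ⟨φk, hφk⟩ := exists_frobenius_absoluteGaloisGroup kv
  obtain ⟨f, hf, hfσ⟩ := exists_reduceTorsionHom h3v hgood h𝔐 ι hσL hφk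
  set σ₀ : absoluteGaloisGroup ℚ := resGalOfEmb ι σL with hσ₀
  have h𝔓₀ : v.primeBelow ι 𝔐 ∈ v.primesAbove := primeBelow_mem_primesAbove h𝔐
  have hσ₀F : IsArithFrobAt (𝓞 ℚ) σ₀ (v.primeBelow ι 𝔐) := isArithFrobAt_resGalOfEmb h𝔐 ι hσL
  -- (1) `σ₀` fixes `μ₉`
  haveI : NeZero (9 : ℕ) := ⟨by norm_num⟩
  haveI : NeZero ((9 : ℕ) : ℚ) := ⟨by norm_num⟩
  have hℓ9nd : ¬ ℓ ∣ 9 := fun h ↦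
    hℓ3 ((Nat.prime_dvd_prime_iff_eq hℓ Nat.prime_three).mp
      (hℓ.dvd_of_dvd_pow (by simpa using h : ℓ ∣ 3 ^ 2)))
  have hσ₀μ : σ₀ ∈ rootsOfUnityFixer ℚ 9 := by
    rw [rootsOfUnityFixer_eq_ker, MonoidHom.mem_ker]
    apply Units.ext
    rw [Units.val_one, Rat.modNCyclotomicCharacter_of_isArithFrobAt hℓ hℓ9nd hv h𝔓₀ hσ₀F]
    have h := (ZMod.natCast_eq_natCast_iff ℓ 1 (3 ^ 2)).mpr hmod1
    simpa using h
  -- (2) Manin's relation on `E[3^∞]`, pulled back along `f`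
  have hrel : ∀ P : geomPrimaryTorsion W 3,
      σ₀ • (σ₀ • P) - W.frobeniusTrace ℓ • (σ₀ • P) + (ℓ : ℤ) • P = 0 := fun P ↦ by
    have hmanin := Wt.frobenius_sq_sub_trace_smul_add_card_smul hφk (f P)
    rw [htr, hcardk, ← hfσ, ← hfσ, ← map_zsmul, ← map_zsmul, ← map_sub, ← map_add,
      ← f.map_zero] at hmanin
    exact hf hmanin
  -- `M = E[9]`, `F = σ₀ - 1`
  have h9mem : ∀ y : geomTorsion W 9, (3 ^ 2) • (y : geomPoints W) = 0 := fun y ↦ by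
    have hy : (9 : ℤ) • (y : geomPoints W) = 0 := (Submodule.mem_torsionBy_iff _ _).mp y.2
    rw [show (3 : ℕ) ^ 2 = 9 by norm_num, ← natCast_zsmul]
    exact_mod_cast hy
  obtain ⟨F, hFdef⟩ : ∃ F : geomTorsion W 9 →+ geomTorsion W 9,
      F = ((W.torsionGaloisModule 9) σ₀).toAddMonoidHom - AddMonoidHom.id _ := ⟨_, rfl⟩
  have hF : ∀ y : geomTorsion W 9, F y = σ₀ • y - y := fun y ↦ by rw [hFdef]; rfl
  have hFcoe : ∀ y : geomTorsion W 9, ((F y : geomTorsion W 9) : geomPoints W) =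
      σ₀ • (y : geomPoints W) - y := fun y ↦ by
    rw [hF, AddSubgroupClass.coe_sub, AddSubgroup.torsionBy.coe_smul]
  -- `F ∘ F = 0`: `(σ₀ - 1)² y = σ₀σ₀y - a_ℓ σ₀y + ℓ y + (a_ℓ - 2) σ₀y - (ℓ - 1) y = 0`
  have hF2 : ∀ y : geomTorsion W 9, F (F y) = 0 := fun y ↦ by
    have hy9 : (9 : ℤ) • (y : geomPoints W) = 0 := (Submodule.mem_torsionBy_iff _ _).mp y.2
    have hσy9 : (9 : ℤ) • (σ₀ • (y : geomPoints W)) = 0 := by rw [smul_comm, hy9, smul_zero]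
    have h1 := congrArg Subtype.val (hrel ⟨(y : geomPoints W), 2, h9mem y⟩)
    simp only [AddSubgroupClass.coe_sub, AddMemClass.coe_add, primaryComponent.coe_smul,
      ZeroMemClass.coe_zero] at h1
    -- h1 : σ₀ • σ₀ • ↑y - a_ℓ • σ₀ • ↑y + ℓ • ↑y = 0  (in `geomPoints W`)
    obtain ⟨c, hc⟩ := ha9
    obtain ⟨d, hd⟩ := hℓ9
    have hca : W.frobeniusTrace ℓ • (σ₀ • (y : geomPoints W)) = (2 : ℤ) • (σ₀ • (y : geomPoints W)) := by
      rw [show W.frobeniusTrace ℓ = 2 + c * 9 by linarith, add_smul, mul_smul, hσy9, smul_zero,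
        add_zero]
    have hdl : (ℓ : ℤ) • (y : geomPoints W) = (y : geomPoints W) := by
      rw [show (ℓ : ℤ) = 1 + d * 9 by linarith, add_smul, one_smul, mul_smul, hy9, smul_zero,
        add_zero]
    rw [hca, hdl] at h1
    apply Subtype.ext
    rw [hFcoe, hFcoe, ZeroMemClass.coe_zero, smul_sub]
    -- goal: σ₀ • (σ₀ • ↑y - ↑y) ... = 0 ; h1: σ₀•σ₀•y - 2•σ₀•y + y = 0
    have e : σ₀ • (σ₀ • (y : geomPoints W)) - σ₀ • (y : geomPoints W) -
        (σ₀ • (y : geomPoints W) - y) =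
        σ₀ • (σ₀ • (y : geomPoints W)) - (2 : ℤ) • (σ₀ • (y : geomPoints W)) + y := by
      rw [two_smul]; abel
    rw [e]
    exact h1
  -- cardinalities: `#E[9] = 81`
  have hM : Nat.card (geomTorsion W 9) = 81 := by
    have h := card_torsionPoints_eq_sq_holds W (AlgebraicClosure ℚ) (n := 9) (by norm_num)
    exact h
  haveI : Finite (geomTorsion W 9) := Nat.finite_of_card_ne_zero (by rw [hM]; norm_num)
  -- (3) the `σ₀`-fixed points `K = ker F` embed into `(E₀ mod ℓ)(ZMod ℓ)`
  set T := ((integralModelInt W).map (Int.castRingHom (ZMod ℓ))).toAffine.Point with hTdef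
  haveI : Finite T := finite_affinePoint _
  let incl9 : geomTorsion W 9 →+ geomPrimaryTorsion W 3 :=
    { toFun := fun y ↦ ⟨y, 2, h9mem y⟩
      map_zero' := rfl
      map_add' := fun _ _ ↦ rfl }
  have hincl9 : Function.Injective incl9 := fun P Q h ↦
    Subtype.ext (congrArg (fun w : geomPrimaryTorsion W 3 => (w : geomPoints W)) h)
  let g : geomTorsion W 9 →+ geomPoints Wt := f.comp incl9
  have hg : Function.Injective g := hf.comp hincl9
  have hgfix : ∀ y : geomTorsion W 9, y ∈ F.ker → φk • g y = g y := fun y hy ↦ by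
    have hσy : σ₀ • y = y := by
      have := (AddMonoidHom.mem_ker).mp hy
      rw [hF, sub_eq_zero] at this
      exact this
    have h1 : σ₀ • incl9 y = incl9 y := by
      apply Subtype.ext
      rw [primaryComponent.coe_smul]
      exact congrArg Subtype.val hσy
    show φk • f (incl9 y) = f (incl9 y)
    rw [← hfσ, h1]
  let bc : (Wt.baseChange kv).toAffine.Point →+ geomPoints Wt :=
    Affine.Point.baseChange kv (AlgebraicClosure kv)
  have hbc : Function.Injective bc := Affine.Point.map_injective _
  have hrange : ∀ y : F.ker, g (y : geomTorsion W 9) ∈ bc.range := fun y ↦ by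
    obtain ⟨R₀, hR₀⟩ := exists_baseChange_eq_of_frobenius_smul_eq Wt hφk (hgfix y y.2)
    exact ⟨R₀, hR₀⟩
  let gK : F.ker →+ bc.range := (g.comp F.ker.subtype).codRestrict bc.range hrange
  let e : (Wt.baseChange kv).toAffine.Point ≃+ bc.range := AddMonoidHom.ofInjective hbc
  obtain ⟨j, hj⟩ := exists_addMonoidHom_reductionAt_intModel W (ℓ := ℓ) hvℓ
  let H : F.ker →+ T := j.comp (e.symm.toAddMonoidHom.comp gK)
  have hH : Function.Injective H := by
    refine hj.comp (e.symm.injective.comp ?_)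
    intro P Q hPQ
    have h1 : g (P : geomTorsion W 9) = g (Q : geomTorsion W 9) := congrArg Subtype.val hPQ
    exact Subtype.ext (hg h1)
  -- hence `#K[3] ≤ 3`
  have hK3 : Nat.card {y : F.ker // (3 : ℕ) • y = 0} ≤ 3 := by
    refine le_trans (Nat.card_le_card_of_injective (fun y => (⟨H y.1, ?_⟩ : {P : T // 3 • P = 0})) ?_) hle
    · rw [← map_nsmul, y.2, map_zero]
    · intro y₁ y₂ h
      have h' : H y₁.1 = H y₂.1 := congrArg (fun w : {P : T // 3 • P = 0} => (w : T)) h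
      exact Subtype.ext (hH h')
  -- `K` is killed by `9`
  have hK9 : ∀ y : F.ker, (9 : ℕ) • y = 0 := fun y ↦ by
    have h : (9 : ℕ) • ((y : geomTorsion W 9) : geomPoints W) = 0 := by
      have h' := h9mem (y : geomTorsion W 9)
      rwa [show (3 : ℕ) ^ 2 = 9 by norm_num] at h'
    apply Subtype.ext
    apply Subtype.ext
    rw [AddSubgroupClass.coe_nsmul, AddSubgroupClass.coe_nsmul, ZeroMemClass.coe_zero,
      ZeroMemClass.coe_zero]
    exact h
  -- (4) counting: `#K ≤ 9`, hence `#K = 9`, `F(M) = K`, `K` cyclic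
  have hKle : Nat.card F.ker ≤ 9 := ExoticDepthTwo.natCard_le_nine hK9 hK3
  obtain ⟨hK9card, hRK⟩ := ExoticDepthTwo.range_eq_ker_of_sq_eq_zero hM F hF2 hKle
  have hcyc : IsAddCyclic F.ker := ExoticDepthTwo.isAddCyclic_of_card_eq_nine hK9card hK9 hK3
  obtain ⟨gen, hgen⟩ := hcyc.exists_generator
  -- (5) `E[9]/F(E[9]) ≃+ ℤ/9`
  have e₁ : geomTorsion W 9 ⧸ F.range ≃+ geomTorsion W 9 ⧸ F.ker :=
    QuotientAddGroup.quotientAddEquivOfEq hRK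
  have e₂ : geomTorsion W 9 ⧸ F.ker ≃+ F.range := QuotientAddGroup.quotientKerEquivRange F
  have e₃ : F.range ≃+ F.ker := AddEquiv.addSubgroupCongr hRK
  have e₄ : ZMod 9 ≃+ F.ker := zmodAddEquivOfGenerator hgen hK9card
  have eqv : geomTorsion W 9 ⧸ F.range ≃+ ZMod 9 := (e₁.trans (e₂.trans e₃)).trans e₄.symm
  -- (6) contradiction with p13's no-τ theorem
  subst hFdef
  exact not_levelTwoTau_of_surj_three_of_not_surj_nine W hsurj hns9 σ₀ hσ₀μ ⟨eqv⟩

/-- **The depth-`2` transversal level set of an exotic row is `{1}`** (control C-EXO in the cell's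
Kurihara vocabulary): if `n` is a square-free product of Kolyvagin primes of depth `2` at `p = 3`
(`Kato.IsKolyvaginProduct W 3 2 n`) and a cyclic Kolyvagin level (`IsCyclicKolyvaginLevel W 3 n`:
every `ℓ ∣ n` has `#(E₀ mod ℓ)(𝔽_ℓ)[3] ≤ 3`), then `n = 1`. So on an exotic row Kurihara numbers
`δ̃_n` with `I_n ⊆ 9ℤ₃` exist only at `n = 1`: the `ν`-certificates live at depth `1`.
[cite: Kim2022StructureSelmer, §1.2.2 and Thm. 2.1] [cite: Kurihara2014, §3.1]
[cite: Sakamoto2024, §2 (H.2)] -/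
theorem eq_one_of_isKolyvaginProduct_two_of_isCyclicKolyvaginLevel_of_exotic
    (hsurj : W.HasSurjectiveModNGaloisRep 3) (hns9 : ¬ W.HasSurjectiveModNGaloisRep 9) {n : ℕ}
    (hn2 : Kato.IsKolyvaginProduct W 3 2 n) (hcyc : IsCyclicKolyvaginLevel W 3 n) : n = 1 := by
  have hn0 : n ≠ 0 := Squarefree.ne_zero hn2.1
  have hempty : n.primeFactors = ∅ := by
    by_contra hne
    obtain ⟨ℓ, hℓ⟩ := Finset.nonempty_iff_ne_empty.mpr hne
    haveI : Fact ℓ.Prime := ⟨Nat.prime_of_mem_primeFactors hℓ⟩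
    have hK : Kato.IsKolyvaginPrime W 3 2 ℓ := hn2.2 ℓ hℓ
    have hle := hcyc.2 ℓ (Nat.dvd_of_mem_primeFactors hℓ)
    exact absurd hle (not_le.mpr (three_lt_natCard_torsion_intModel_of_exotic W hsurj hns9 hK))
  rcases Nat.primeFactors_eq_empty.mp hempty with h | h
  · exact absurd h hn0
  · exact h

end Exotic

end Summit.BirchSwinnertonDyer.Rank1Residual.GaloisImage

end
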